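import Literature.AlgebraicGeometry.Deformation.LiftedTransitions
import Literature.AlgebraicGeometry.Modules.DeterminantCocycleExact
import Literature.AlgebraicGeometry.Modules.LocallyFreeTrace
import Mathlib.Data.Matrix.Block
import HarnessLib

/-!
# Block upper triangular frames and lifted transition matrices along a short exact sequence

Let `i : Z₀ ⟶ Z₁` be a morphism of schemes (a closed immersion / first-order thickening in the
applications) and `0 → F₁ → F₂ → F₃ → 0` a short exact sequence of `𝒪_{Z₀}`-modules with `F₁`,
`F₃` finite locally free. Over opens `U_a ⊆ Z₁` choose frames `e¹_a`, `e³_a` of `F₁`, `F₃` on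
`i⁻¹U_a` and lifts `t_{a,k} ∈ Γ(F₂, i⁻¹U_a)` of the basis sections of `e³_a` through `F₂ → F₃`
(an `AdaptedFrameCover`). The adapted frames of `F₂` (`Modules/AdaptedFrame.lean`) then form a
frame cover of `F₂` (`cover₂`) whose transition matrices are BLOCK UPPER TRIANGULAR with diagonal
blocks the transition matrices of `F₁` and `F₃` (`trans_cover₂`: Hartshorne II Ex. 5.16 (d), the
matrix form of "`0 → F₁ → F₂ → F₃ → 0` is locally split compatibly with frames"). Given systems of
lifts `T̃¹`, `T̃³` of the transition matrices of `F₁`, `F₃` to `Z₁` (`FrameCover.Lifts`,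
`Deformation/LiftedTransitions.lean`) and any lift `X_{ab}` of the off-diagonal block, the block
matrices `[[T̃¹, X], [0, T̃³]]` are a system of lifts for `F₂` (`Lifts.adapted`) whose DEFECT
`c_{abd} = T̃_{ab} T̃_{bd} - T̃_{ad}` is again block upper triangular with diagonal blocks the defects
of `T̃¹` and `T̃³` (`defect_adapted`). This is the cochain-level input of the additivity of traces
of obstruction classes along short exact sequences (Buchweitz–Flenner 2003, Prop. 4.2 with 4.4, in
the elementary form "filtered Čech cocycles are block triangular, and the trace of a block
triangular matrix is the sum of the diagonal traces": `trace_fromBlocks_mul_fromBlocks`).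
Finally, adapted frame covers by AFFINE opens of `Z₁` exist as soon as `i` is a surjective closed
immersion, e.g. a first-order thickening (`exists_adaptedFrameCover`). Everything is proved; no
named facts.

## References

* R. Hartshorne, *Algebraic Geometry*, GTM 52 (1977), II Ex. 5.7 (b), II Ex. 5.16 (d). [Hartshorne1977]
* R. Hartshorne, *Deformation Theory*, GTM 257 (2010), §7, proof of Thm. 7.1. [Hartshorne2010]
* R.-O. Buchweitz, H. Flenner, *A semiregularity map for modules and applications to
  deformations*, Compositio Math. 137 (2003), Prop. 4.2, Prop. 4.4. [BuchweitzFlenner2003]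
-/

noncomputable section

open CategoryTheory AlgebraicGeometry Opposite TopologicalSpace Limits

universe u

/-! ### Transition matrices of adapted frames are block upper triangular -/

namespace Literature.AlgebraicGeometry.Modules

open Literature.AlgebraicGeometry.Motives

variable {X : Scheme.{u}} {S : ShortComplex X.Modules} (hS : S.ShortExact) {W W' V : X.Opens}
  {I K I' K' : Type u} [Fintype I] [Fintype K]
  (e₁ : SheafOfModules.free I ≅ S.X₁.over W) (e₃ : SheafOfModules.free K ≅ S.X₃.over W)
  (t : K → Γ(S.X₂, W)) (ht : ∀ k, S.g.app W (t k) = basisSection e₃ k)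
  (e₁' : SheafOfModules.free I' ≅ S.X₁.over W') (e₃' : SheafOfModules.free K' ≅ S.X₃.over W')
  (t' : K' → Γ(S.X₂, W')) (ht' : ∀ k, S.g.app W' (t' k) = basisSection e₃' k)
  (k : V ⟶ W) (k' : V ⟶ W')

/-- **First block column** of the transition matrix between two adapted frames: the coordinates of
the `F₁`-part of the frame over `W'` are `(T(e¹, e¹'), 0)`. [cite: Hartshorne1977, II Ex. 5.16 (d)] -/
theorem transition_adaptedFrame_inl (j : I') (s : I ⊕ K) :
    transition (adaptedFrame hS e₁ e₃ t ht) (adaptedFrame hS e₁' e₃' t' ht') k k' s (Sum.inl j) =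
      Sum.elim (fun i => transition e₁ e₁' k k' i j) 0 s := by
  rw [transition_apply]
  refine coord_adaptedFrame_of_eq_sum hS e₁ e₃ t ht k _ _ _ ?_ s
  change S.X₂.presheaf.map k'.op (basisSection (E := S.X₂) (adaptedFrame hS e₁' e₃' t' ht')
    (Sum.inl j)) = _
  rw [basisSection_adaptedFrame_inl, ← Scheme.Modules.Hom.app_map_apply,
    map_basisSection_eq_sum_transition e₁ e₁' k k' j, map_sum]
  simp only [Pi.zero_apply, zero_smul, Finset.sum_const_zero, add_zero, Scheme.Modules.Hom.app_smul,
    Scheme.Modules.Hom.app_map_apply]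

/-- **Second diagonal block**: the `F₃`-coordinates of the lifted part of the frame over `W'` are
`T(e³, e³')`. [cite: Hartshorne1977, II Ex. 5.16 (d)] -/
theorem transition_adaptedFrame_inr_inr (m : K) (l : K') :
    transition (adaptedFrame hS e₁ e₃ t ht) (adaptedFrame hS e₁' e₃' t' ht') k k' (Sum.inr m)
        (Sum.inr l) = transition e₃ e₃' k k' m l := by
  set T := transition (adaptedFrame hS e₁ e₃ t ht) (adaptedFrame hS e₁' e₃' t' ht') k k' with hT
  -- expand the lifted basis section of the frame over `W'` in the frame over `W`, and apply `g`
  have hexp := map_basisSection_eq_sum_transition (I := I ⊕ K) (adaptedFrame hS e₁ e₃ t ht)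
    (adaptedFrame hS e₁' e₃' t' ht') k k' (Sum.inr l)
  have hgexp := congrArg (S.g.app V) hexp
  rw [map_sum, Fintype.sum_sum_type] at hgexp
  change S.g.app V (S.X₂.presheaf.map k'.op (basisSection (E := S.X₂)
      (adaptedFrame hS e₁' e₃' t' ht') (Sum.inr l))) =
    ∑ i, S.g.app V (T (Sum.inl i) (Sum.inr l) • S.X₂.presheaf.map k.op
      (basisSection (E := S.X₂) (adaptedFrame hS e₁ e₃ t ht) (Sum.inl i))) +
    ∑ m, S.g.app V (T (Sum.inr m) (Sum.inr l) • S.X₂.presheaf.map k.op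
      (basisSection (E := S.X₂) (adaptedFrame hS e₁ e₃ t ht) (Sum.inr m))) at hgexp
  simp only [basisSection_adaptedFrame_inl, basisSection_adaptedFrame_inr,
    Scheme.Modules.Hom.app_smul, Scheme.Modules.Hom.app_map_apply, g_app_f_app,
    map_zero, smul_zero, Finset.sum_const_zero, zero_add, ht, ht'] at hgexp
  -- `hgexp : b³'_l|_V = ∑_m T_{ml} b³_m|_V` in the frames of `F₃`
  have hc := congrArg (fun s => coord e₃ k s m) hgexp
  simp only [coord_sum_smul_basisSection] at hc
  rw [← hc, ← transition_apply]

/-- The lower left block vanishes. [cite: Hartshorne1977, II Ex. 5.16 (d)] -/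
theorem transition_adaptedFrame_inr_inl (m : K) (j : I') :
    transition (adaptedFrame hS e₁ e₃ t ht) (adaptedFrame hS e₁' e₃' t' ht') k k' (Sum.inr m)
      (Sum.inl j) = 0 := by
  rw [transition_adaptedFrame_inl]
  rfl

/-- The upper left block is `T(e¹, e¹')`. [cite: Hartshorne1977, II Ex. 5.16 (d)] -/
theorem transition_adaptedFrame_inl_inl (i : I) (j : I') :
    transition (adaptedFrame hS e₁ e₃ t ht) (adaptedFrame hS e₁' e₃' t' ht') k k' (Sum.inl i)
      (Sum.inl j) = transition e₁ e₁' k k' i j := by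
  rw [transition_adaptedFrame_inl]
  rfl

/-- The (unconstrained) upper right block of the transition matrix of two adapted frames: the
`F₁`-coordinates of the lifts `t'`. [folklore] -/
def adaptedOffDiag : Matrix I K' Γ(X, V) :=
  Matrix.of fun i l => transition (adaptedFrame hS e₁ e₃ t ht) (adaptedFrame hS e₁' e₃' t' ht') k k'
    (Sum.inl i) (Sum.inr l)

/-- **The transition matrix of two adapted frames is block upper triangular**
`[[T(e¹,e¹'), *], [0, T(e³,e³')]]`. [cite: Hartshorne1977, II Ex. 5.16 (d)] -/
theorem transition_adaptedFrame_eq_fromBlocks :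
    transition (adaptedFrame hS e₁ e₃ t ht) (adaptedFrame hS e₁' e₃' t' ht') k k' =
      Matrix.fromBlocks (transition e₁ e₁' k k') (adaptedOffDiag hS e₁ e₃ t ht e₁' e₃' t' ht' k k')
        0 (transition e₃ e₃' k k') := by
  ext s s'
  rcases s with i | m <;> rcases s' with j | l
  · rw [Matrix.fromBlocks_apply₁₁, transition_adaptedFrame_inl_inl]
  · rfl
  · rw [Matrix.fromBlocks_apply₂₁, transition_adaptedFrame_inr_inl, Matrix.zero_apply]
  · rw [Matrix.fromBlocks_apply₂₂, transition_adaptedFrame_inr_inr]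

/-! ### Block upper triangular matrix algebra (trace of products) -/

omit [Fintype I] [Fintype K] in
/-- Entrywise maps of block upper triangular matrices. [folklore] -/
theorem fromBlocks_zero₂₁_map {R R' : Type*} [Zero R] [Zero R'] {l m n o : Type*}
    (A : Matrix n l R) (B : Matrix n m R) (D : Matrix o m R) (f : R → R') (hf : f 0 = 0) :
    (Matrix.fromBlocks A B 0 D).map f = Matrix.fromBlocks (A.map f) (B.map f) 0 (D.map f) := by
  rw [Matrix.fromBlocks_map, Matrix.map_zero f hf]

omit [Fintype I] [Fintype K] in
/-- Subtraction of block matrices. [folklore] -/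
theorem fromBlocks_sub_fromBlocks {R : Type*} [Sub R] {l m n o : Type*}
    (A : Matrix n l R) (B : Matrix n m R) (C : Matrix o l R) (D : Matrix o m R)
    (A' : Matrix n l R) (B' : Matrix n m R) (C' : Matrix o l R) (D' : Matrix o m R) :
    Matrix.fromBlocks A B C D - Matrix.fromBlocks A' B' C' D' =
      Matrix.fromBlocks (A - A') (B - B') (C - C') (D - D') := by
  ext i j; rcases i with ⟨⟩ <;> rcases j with ⟨⟩ <;> rfl

omit [Fintype I] [Fintype K] in
/-- The trace of a block matrix is the sum of the traces of its diagonal blocks. [folklore] -/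
theorem trace_fromBlocks' {R : Type*} [AddCommMonoid R] {n o : Type*} [Fintype n] [Fintype o]
    (A : Matrix n n R) (B : Matrix n o R) (C : Matrix o n R) (D : Matrix o o R) :
    Matrix.trace (Matrix.fromBlocks A B C D) = Matrix.trace A + Matrix.trace D := by
  simp [Matrix.trace, Fintype.sum_sum_type]

omit [Fintype I] [Fintype K] in
/-- The product of two block upper triangular matrices is block upper triangular with the products
of the diagonal blocks on the diagonal. [folklore] -/
theorem fromBlocks_zero₂₁_mul_fromBlocks_zero₂₁ {R : Type*} [NonUnitalNonAssocSemiring R]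
    {l m n o p q : Type*} [Fintype l] [Fintype m]
    (A : Matrix n l R) (B : Matrix n m R) (D : Matrix o m R)
    (A' : Matrix l p R) (B' : Matrix l q R) (D' : Matrix m q R) :
    Matrix.fromBlocks A B 0 D * Matrix.fromBlocks A' B' 0 D' =
      Matrix.fromBlocks (A * A') (A * B' + B * D') 0 (D * D') := by
  rw [Matrix.fromBlocks_multiply]
  simp

omit [Fintype I] [Fintype K] in
/-- **The trace of a product of block upper triangular matrices is the sum of the traces of the
products of the diagonal blocks** (the linear algebra behind the additivity of traces of filtered
cocycles). [folklore] -/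
theorem trace_fromBlocks_mul_fromBlocks {R : Type*} [NonUnitalNonAssocSemiring R] {l m n o : Type*}
    [Fintype l] [Fintype m] [Fintype n] [Fintype o]
    (A : Matrix n l R) (B : Matrix n m R) (D : Matrix o m R)
    (A' : Matrix l n R) (B' : Matrix l o R) (D' : Matrix m o R) :
    Matrix.trace (Matrix.fromBlocks A B 0 D * Matrix.fromBlocks A' B' 0 D') =
      Matrix.trace (A * A') + Matrix.trace (D * D') := by
  rw [fromBlocks_zero₂₁_mul_fromBlocks_zero₂₁, trace_fromBlocks']

end Literature.AlgebraicGeometry.Modules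

/-! ### Adapted frame covers and block upper triangular systems of lifts -/

namespace Literature.AlgebraicGeometry.Deformation

open Literature.AlgebraicGeometry.Modules Literature.AlgebraicGeometry.Motives

variable {Z₀ Z₁ : Scheme.{u}} {i : Z₀ ⟶ Z₁} {S : ShortComplex Z₀.Modules} (hS : S.ShortExact)
  {ι : Type u}

variable (i S ι) in
/-- **An adapted frame cover** of a short exact sequence `0 → F₁ → F₂ → F₃ → 0` of
`𝒪_{Z₀}`-modules along `i : Z₀ ⟶ Z₁`: opens `U_a ⊆ Z₁`, frames `e¹_a`, `e³_a` of `F₁`, `F₃` over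
`i⁻¹U_a`, and lifts `t_{a,k} ∈ Γ(F₂, i⁻¹U_a)` of the basis sections of `e³_a` through `F₂ → F₃`.
[cite: Hartshorne1977, II Ex. 5.7 (b)] -/
structure AdaptedFrameCover where
  /-- The open `U_a ⊆ Z₁`. -/
  U : ι → Z₁.Opens
  /-- The index type of the frame of `F₁` over `U_a`. -/
  I₁ : ι → Type u
  /-- The index type of the frame of `F₃` over `U_a`. -/
  I₃ : ι → Type u
  [instFintype₁ : ∀ a, Fintype (I₁ a)]
  [instFintype₃ : ∀ a, Fintype (I₃ a)]
  [instDecidableEq₁ : ∀ a, DecidableEq (I₁ a)]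
  [instDecidableEq₃ : ∀ a, DecidableEq (I₃ a)]
  /-- The frame of `F₁` over `i⁻¹U_a`. -/
  e₁ : ∀ a, SheafOfModules.free (I₁ a) ≅ S.X₁.over (i ⁻¹ᵁ (U a))
  /-- The frame of `F₃` over `i⁻¹U_a`. -/
  e₃ : ∀ a, SheafOfModules.free (I₃ a) ≅ S.X₃.over (i ⁻¹ᵁ (U a))
  /-- The lifts of the basis sections of `e³_a` to `F₂`. -/
  t : ∀ a, I₃ a → Γ(S.X₂, i ⁻¹ᵁ (U a))
  /-- The lifts map to the basis sections. -/
  map_t : ∀ a k, S.g.app _ (t a k) = basisSection (e₃ a) k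

attribute [instance] AdaptedFrameCover.instFintype₁ AdaptedFrameCover.instFintype₃
  AdaptedFrameCover.instDecidableEq₁ AdaptedFrameCover.instDecidableEq₃

namespace AdaptedFrameCover

variable {hS} (A : AdaptedFrameCover i S ι)

/-- The frame cover of `F₁`. [folklore] -/
abbrev cover₁ : FrameCover i S.X₁ ι where
  U := A.U
  I := A.I₁
  e := A.e₁

/-- The frame cover of `F₃`. [folklore] -/
abbrev cover₃ : FrameCover i S.X₃ ι where
  U := A.U
  I := A.I₃
  e := A.e₃

/-- **The adapted frame cover of `F₂`**: over `i⁻¹U_a`, the frame on `I₁ a ⊕ I₃ a` made of the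
frame of `F₁` and the lifts `t_a` (`Modules.adaptedFrame`). [cite: Hartshorne1977, II Ex. 5.7 (b)] -/
abbrev cover₂ (hS : S.ShortExact) : FrameCover i S.X₂ ι where
  U := A.U
  I a := A.I₁ a ⊕ A.I₃ a
  e a := adaptedFrame hS (A.e₁ a) (A.e₃ a) (A.t a) (A.map_t a)

/-- The opens of `cover₁`. [folklore] -/
@[simp] lemma cover₁_U : A.cover₁.U = A.U := rfl
/-- The opens of `cover₃`. [folklore] -/
@[simp] lemma cover₃_U : A.cover₃.U = A.U := rfl
/-- The opens of `cover₂`. [folklore] -/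
@[simp] lemma cover₂_U : (A.cover₂ hS).U = A.U := rfl
/-- The index types of `cover₁`. [folklore] -/
@[simp] lemma cover₁_I (a : ι) : A.cover₁.I a = A.I₁ a := rfl
/-- The index types of `cover₃`. [folklore] -/
@[simp] lemma cover₃_I (a : ι) : A.cover₃.I a = A.I₃ a := rfl
/-- The index types of `cover₂`. [folklore] -/
@[simp] lemma cover₂_I (a : ι) : (A.cover₂ hS).I a = (A.I₁ a ⊕ A.I₃ a) := rfl

/-- The off-diagonal block of the transition matrices of the adapted cover over `i⁻¹V`,
`V ≤ U_a ∩ U_b`. [folklore] -/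
def offDiag (a b : ι) (V : Z₁.Opens) (ha : V ≤ A.U a) (hb : V ≤ A.U b) :
    Matrix (A.I₁ a) (A.I₃ b) Γ(Z₀, i ⁻¹ᵁ V) :=
  adaptedOffDiag hS (A.e₁ a) (A.e₃ a) (A.t a) (A.map_t a) (A.e₁ b) (A.e₃ b) (A.t b) (A.map_t b)
    ((A.cover₂ hS).incl ha) ((A.cover₂ hS).incl hb)

/-- **The transition matrices of the adapted cover are block upper triangular**, with diagonal
blocks the transition matrices of the covers of `F₁` and `F₃`. [cite: Hartshorne1977, II Ex. 5.16 (d)] -/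
theorem trans_cover₂ (a b : ι) (V : Z₁.Opens) (ha : V ≤ A.U a) (hb : V ≤ A.U b) :
    (A.cover₂ hS).trans a b V ha hb =
      Matrix.fromBlocks (A.cover₁.trans a b V ha hb) (A.offDiag (hS := hS) a b V ha hb) 0
        (A.cover₃.trans a b V ha hb) :=
  transition_adaptedFrame_eq_fromBlocks hS _ _ _ _ _ _ _ _ _ _

/-- The off-diagonal block is compatible with restriction. [folklore] -/
lemma offDiag_map (a b : ι) {V V' : Z₁.Opens} (ha : V ≤ A.U a) (hb : V ≤ A.U b) (h : V' ≤ V) :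
    (A.offDiag (hS := hS) a b V ha hb).map (secRes Z₀ ((Opens.map i.base).map (homOfLE h)).le) =
      A.offDiag (hS := hS) a b V' (h.trans ha) (h.trans hb) := by
  have e := (A.cover₂ hS).trans_map a b ha hb h
  rw [trans_cover₂, trans_cover₂] at e
  have e' := congrArg Matrix.toBlocks₁₂ e
  rw [Matrix.toBlocks₁₂] at e'
  ext j l
  have := congrFun (congrFun e' j) l
  simpa [Matrix.fromBlocks_apply₁₂] using this

/-! ### Block upper triangular systems of lifts -/

namespace Lifts

variable {A}

/-- **The adapted system of lifts** `[[T̃¹, X], [0, T̃³]]` of the transition matrices of `F₂`, from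
systems of lifts for `F₁`, `F₃` and any lift `X_{ab}` of the off-diagonal blocks.
[cite: Hartshorne2010, §7 (proof of Thm. 7.1)] -/
def adapted (L₁ : A.cover₁.Lifts) (L₃ : A.cover₃.Lifts)
    (X : ∀ a b, Matrix (A.I₁ a) (A.I₃ b) Γ(Z₁, A.U a ⊓ A.U b))
    (hX : ∀ a b, (X a b).map (i.app (A.U a ⊓ A.U b)).hom =
      A.offDiag (hS := hS) a b (A.U a ⊓ A.U b) inf_le_left inf_le_right) :
    (A.cover₂ hS).Lifts where
  T a b := Matrix.fromBlocks (L₁.T a b) (X a b) 0 (L₃.T a b)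
  map_T a b := by
    change (Matrix.fromBlocks (L₁.T a b) (X a b) 0 (L₃.T a b)).map (i.app (A.U a ⊓ A.U b)).hom =
      (A.cover₂ hS).trans a b (A.U a ⊓ A.U b) inf_le_left inf_le_right
    rw [trans_cover₂, fromBlocks_zero₂₁_map _ _ _ _ (map_zero _), L₁.map_T, L₃.map_T, hX]

/-- Lifts of the off-diagonal blocks exist when the pairwise intersections are affine (`i` a closed
immersion). [cite: StacksProject, Tag 01QN] -/
lemma exists_offDiag_lift [IsClosedImmersion i] (hU : ∀ a b, IsAffineOpen (A.U a ⊓ A.U b)) :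
    ∃ X : ∀ a b, Matrix (A.I₁ a) (A.I₃ b) Γ(Z₁, A.U a ⊓ A.U b),
      ∀ a b, (X a b).map (i.app (A.U a ⊓ A.U b)).hom =
        A.offDiag (hS := hS) a b (A.U a ⊓ A.U b) inf_le_left inf_le_right :=
  ⟨fun a b => Matrix.of fun j l => Function.surjInv (i.app_surjective (A.U a ⊓ A.U b) (hU a b))
      (A.offDiag (hS := hS) a b (A.U a ⊓ A.U b) inf_le_left inf_le_right j l),
    fun a b => by
      ext j l
      exact Function.surjInv_eq (i.app_surjective (A.U a ⊓ A.U b) (hU a b)) _⟩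

variable (L₁ : A.cover₁.Lifts) (L₃ : A.cover₃.Lifts)
  (X : ∀ a b, Matrix (A.I₁ a) (A.I₃ b) Γ(Z₁, A.U a ⊓ A.U b))
  (hX : ∀ a b, (X a b).map (i.app (A.U a ⊓ A.U b)).hom =
    A.offDiag (hS := hS) a b (A.U a ⊓ A.U b) inf_le_left inf_le_right)

/-- The adapted lifts restricted to `V`: `[[T̃¹|_V, X|_V], [0, T̃³|_V]]`. [folklore] -/
theorem TOn_adapted (a b : ι) (V : Z₁.Opens) (ha : V ≤ A.U a) (hb : V ≤ A.U b) :
    (adapted (hS := hS) L₁ L₃ X hX).TOn a b V ha hb =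
      Matrix.fromBlocks (L₁.TOn a b V ha hb) ((X a b).map (secRes Z₁ (le_inf ha hb))) 0
        (L₃.TOn a b V ha hb) := by
  change (Matrix.fromBlocks (L₁.T a b) (X a b) 0 (L₃.T a b)).map (secRes Z₁ (le_inf ha hb)) = _
  rw [fromBlocks_zero₂₁_map _ _ _ _ (map_zero _)]
  rfl

/-- **The defect of the adapted lifts is block upper triangular with diagonal blocks the defects of
`T̃¹` and `T̃³`**: `c²_{abd} = [[c¹_{abd}, *], [0, c³_{abd}]]`.
[cite: Hartshorne2010, §7 (proof of Thm. 7.1)] -/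
theorem defect_adapted (a b d : ι) (V : Z₁.Opens) (ha : V ≤ A.U a) (hb : V ≤ A.U b)
    (hd : V ≤ A.U d) :
    (adapted (hS := hS) L₁ L₃ X hX).defect a b d V ha hb hd =
      Matrix.fromBlocks (L₁.defect a b d V ha hb hd)
        (L₁.TOn a b V ha hb * (X b d).map (secRes Z₁ (le_inf hb hd)) +
          (X a b).map (secRes Z₁ (le_inf ha hb)) * L₃.TOn b d V hb hd -
            (X a d).map (secRes Z₁ (le_inf ha hd)))
        0 (L₃.defect a b d V ha hb hd) := by
  rw [FrameCover.Lifts.defect, TOn_adapted, TOn_adapted, TOn_adapted,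
    fromBlocks_zero₂₁_mul_fromBlocks_zero₂₁, fromBlocks_sub_fromBlocks, sub_zero]
  rfl

/-- Upper left block of the defect of the adapted lifts. [folklore] -/
theorem defect_adapted_inl_inl (a b d : ι) (V : Z₁.Opens) (ha : V ≤ A.U a) (hb : V ≤ A.U b)
    (hd : V ≤ A.U d) (j : A.I₁ a) (l : A.I₁ d) :
    (adapted (hS := hS) L₁ L₃ X hX).defect a b d V ha hb hd (Sum.inl j) (Sum.inl l) =
      L₁.defect a b d V ha hb hd j l := by
  rw [defect_adapted, Matrix.fromBlocks_apply₁₁]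

/-- Lower right block of the defect of the adapted lifts. [folklore] -/
theorem defect_adapted_inr_inr (a b d : ι) (V : Z₁.Opens) (ha : V ≤ A.U a) (hb : V ≤ A.U b)
    (hd : V ≤ A.U d) (j : A.I₃ a) (l : A.I₃ d) :
    (adapted (hS := hS) L₁ L₃ X hX).defect a b d V ha hb hd (Sum.inr j) (Sum.inr l) =
      L₃.defect a b d V ha hb hd j l := by
  rw [defect_adapted, Matrix.fromBlocks_apply₂₂]

/-- Lower left block of the defect of the adapted lifts vanishes. [folklore] -/
theorem defect_adapted_inr_inl (a b d : ι) (V : Z₁.Opens) (ha : V ≤ A.U a) (hb : V ≤ A.U b)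
    (hd : V ≤ A.U d) (j : A.I₃ a) (l : A.I₁ d) :
    (adapted (hS := hS) L₁ L₃ X hX).defect a b d V ha hb hd (Sum.inr j) (Sum.inl l) = 0 := by
  rw [defect_adapted, Matrix.fromBlocks_apply₂₁, Matrix.zero_apply]

/-- **Additivity of the traces of the defect read in a frame**: for any block upper triangular
matrix `N = [[N¹, *], [0, N³]]` over `V` (e.g. a lift `T̃_{da}` or a reduced transition matrix),
`tr(c²_{abd} N) = tr(c¹_{abd} N¹) + tr(c³_{abd} N³)`. [cite: BuchweitzFlenner2003, Prop. 4.2] -/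
theorem trace_defect_adapted_mul_fromBlocks (a b d : ι) (V : Z₁.Opens) (ha : V ≤ A.U a)
    (hb : V ≤ A.U b) (hd : V ≤ A.U d) (N₁ : Matrix (A.I₁ d) (A.I₁ a) Γ(Z₁, V))
    (N₂ : Matrix (A.I₁ d) (A.I₃ a) Γ(Z₁, V)) (N₃ : Matrix (A.I₃ d) (A.I₃ a) Γ(Z₁, V)) :
    Matrix.trace ((adapted (hS := hS) L₁ L₃ X hX).defect a b d V ha hb hd *
        Matrix.fromBlocks N₁ N₂ 0 N₃) =
      Matrix.trace (L₁.defect a b d V ha hb hd * N₁) +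
        Matrix.trace (L₃.defect a b d V ha hb hd * N₃) := by
  rw [defect_adapted, trace_fromBlocks_mul_fromBlocks]

end Lifts

end AdaptedFrameCover

/-! ### Existence of adapted frame covers by affine opens -/

section Existence

variable (i) [IsClosedImmersion i]

/-- For a surjective closed immersion (a homeomorphism onto its target) every open of the source is
the preimage of an open of the target: the complement of the image of the complement.
[cite: StacksProject, Tag 08KY] -/
def openOfPreimage (O : Z₀.Opens) : Z₁.Opens :=
  ⟨(i.base '' (O : Set Z₀)ᶜ)ᶜ, (i.isClosedEmbedding.isClosedMap _ O.isOpen.isClosed_compl).isOpen_compl⟩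

/-- `i⁻¹(openOfPreimage O) = O`. [folklore] -/
lemma preimage_openOfPreimage (O : Z₀.Opens) : i ⁻¹ᵁ (openOfPreimage i O) = O := by
  ext x
  change i.base x ∈ (i.base '' (O : Set Z₀)ᶜ)ᶜ ↔ x ∈ (O : Set Z₀)
  rw [Set.mem_compl_iff, Set.mem_image]
  constructor
  · intro h
    by_contra hx
    exact h ⟨x, hx, rfl⟩
  · rintro hx ⟨y, hy, hyx⟩
    exact hy (i.isClosedEmbedding.injective hyx ▸ hx)

/-- `i x ∈ openOfPreimage O ↔ x ∈ O`. [folklore] -/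
lemma mem_openOfPreimage {O : Z₀.Opens} {x : Z₀} : i.base x ∈ openOfPreimage i O ↔ x ∈ O := by
  change x ∈ i ⁻¹ᵁ (openOfPreimage i O) ↔ x ∈ O
  rw [preimage_openOfPreimage]

/-- Around every point of `Z₀`, inside a given open `O ∋ x`, there is the preimage of an AFFINE open
of `Z₁`. [folklore] -/
lemma exists_isAffineOpen_preimage_le {O : Z₀.Opens} {x : Z₀} (hx : x ∈ O) :
    ∃ U : Z₁.Opens, IsAffineOpen U ∧ i.base x ∈ U ∧ i ⁻¹ᵁ U ≤ O := by
  obtain ⟨U, hU, hxU, hUO⟩ := Opens.isBasis_iff_nbhd.mp Z₁.isBasis_affineOpens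
    ((mem_openOfPreimage i).mpr hx : i.base x ∈ openOfPreimage i O)
  refine ⟨U, hU, hxU, ?_⟩
  calc i ⁻¹ᵁ U ≤ i ⁻¹ᵁ (openOfPreimage i O) := (Opens.map i.base).monotone hUO
    _ = O := preimage_openOfPreimage i O

variable (h₁ : IsFiniteLocallyFree S.X₁) (h₃ : IsFiniteLocallyFree S.X₃)

include hS in
/-- The basis sections of the chosen frame of `F₃` at `x` lift locally through `F₂ → F₃`.
[folklore] -/
lemma exists_local_lift (x : Z₀) (k : TrivIndex h₃ x) :
    ∃ (V : Z₀.Opens) (hV : V ≤ trivNbhd h₃ x), x ∈ V ∧ ∃ s : Γ(S.X₂, V),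
      S.g.app V s = S.X₃.presheaf.map (homOfLE hV).op (basisSection (trivFrame h₃ x) k) :=
  haveI := hS.epi_g
  Scheme.Modules.exists_app_eq_of_epi S.g _ _ x (mem_trivNbhd h₃ x)

/-- The open of `Z₀` around `x` on which `F₁`, `F₃` are framed and the basis of `F₃` lifts.
[folklore] -/
def adaptedOpen (x : Z₀) : Z₀.Opens :=
  trivNbhd h₁ x ⊓ trivNbhd h₃ x ⊓ ⨅ k, (exists_local_lift hS h₃ x k).choose

/-- `x ∈ adaptedOpen x`. [folklore] -/
lemma mem_adaptedOpen (x : Z₀) : x ∈ adaptedOpen hS h₁ h₃ x := by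
  refine ⟨⟨mem_trivNbhd h₁ x, mem_trivNbhd h₃ x⟩, ?_⟩
  change x ∈ ((⨅ k, (exists_local_lift hS h₃ x k).choose : Z₀.Opens) : Set Z₀)
  rw [Opens.coe_iInf]
  exact Set.mem_iInter.mpr fun k => (exists_local_lift hS h₃ x k).choose_spec.2.1

/-- `adaptedOpen x ≤ U₁`. [folklore] -/
lemma adaptedOpen_le₁ (x : Z₀) : adaptedOpen hS h₁ h₃ x ≤ trivNbhd h₁ x :=
  inf_le_left.trans inf_le_left

/-- `adaptedOpen x ≤ U₃`. [folklore] -/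
lemma adaptedOpen_le₃ (x : Z₀) : adaptedOpen hS h₁ h₃ x ≤ trivNbhd h₃ x :=
  inf_le_left.trans inf_le_right

/-- `adaptedOpen x` lies in the opens where the basis lifts. [folklore] -/
lemma adaptedOpen_le_lift (x : Z₀) (k : TrivIndex h₃ x) :
    adaptedOpen hS h₁ h₃ x ≤ (exists_local_lift hS h₃ x k).choose :=
  inf_le_right.trans (iInf_le _ k)

/-- The chosen affine open `U_x ⊆ Z₁` with `i x ∈ U_x` and `i⁻¹U_x` inside the adapted open.
[folklore] -/
def affineAdaptedOpen (x : Z₀) : Z₁.Opens :=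
  (exists_isAffineOpen_preimage_le (i := i) (mem_adaptedOpen hS h₁ h₃ x)).choose

/-- `affineAdaptedOpen x` is affine. [folklore] -/
lemma isAffineOpen_affineAdaptedOpen (x : Z₀) : IsAffineOpen (affineAdaptedOpen i hS h₁ h₃ x) :=
  (exists_isAffineOpen_preimage_le (i := i) (mem_adaptedOpen hS h₁ h₃ x)).choose_spec.1

/-- `i x ∈ affineAdaptedOpen x`. [folklore] -/
lemma mem_affineAdaptedOpen (x : Z₀) : i.base x ∈ affineAdaptedOpen i hS h₁ h₃ x :=
  (exists_isAffineOpen_preimage_le (i := i) (mem_adaptedOpen hS h₁ h₃ x)).choose_spec.2.1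

/-- `i⁻¹(affineAdaptedOpen x) ≤ adaptedOpen x`. [folklore] -/
lemma preimage_affineAdaptedOpen_le (x : Z₀) :
    i ⁻¹ᵁ affineAdaptedOpen i hS h₁ h₃ x ≤ adaptedOpen hS h₁ h₃ x :=
  (exists_isAffineOpen_preimage_le (i := i) (mem_adaptedOpen hS h₁ h₃ x)).choose_spec.2.2

/-- **The canonical adapted frame cover by affine opens** (indexed by the points of `Z₀`): at `x`,
the chosen frames of `F₁`, `F₃` and local lifts of the basis of `F₃`, all restricted to the preimage
of an affine open `U_x ∋ i(x)` of `Z₁`. [cite: Hartshorne1977, II Ex. 5.7 (b)] -/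
def adaptedFrameCover : AdaptedFrameCover i S Z₀ where
  U := affineAdaptedOpen i hS h₁ h₃
  I₁ x := TrivIndex h₁ x
  I₃ x := TrivIndex h₃ x
  instDecidableEq₁ x := Classical.typeDecidableEq _
  instDecidableEq₃ x := Classical.typeDecidableEq _
  e₁ x := SheafOfModules.restrictTrivialisation (R := Z₀.ringCatSheaf)
    (homOfLE ((preimage_affineAdaptedOpen_le i hS h₁ h₃ x).trans (adaptedOpen_le₁ hS h₁ h₃ x)))
    (trivFrame h₁ x)
  e₃ x := SheafOfModules.restrictTrivialisation (R := Z₀.ringCatSheaf)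
    (homOfLE ((preimage_affineAdaptedOpen_le i hS h₁ h₃ x).trans (adaptedOpen_le₃ hS h₁ h₃ x)))
    (trivFrame h₃ x)
  t x k := S.X₂.presheaf.map (homOfLE ((preimage_affineAdaptedOpen_le i hS h₁ h₃ x).trans
    (adaptedOpen_le_lift hS h₁ h₃ x k))).op (exists_local_lift hS h₃ x k).choose_spec.2.2.choose
  map_t x k := by
    rw [Scheme.Modules.Hom.app_map_apply, (exists_local_lift hS h₃ x k).choose_spec.2.2.choose_spec,
      presheaf_map_map, basisSection_restrictTrivialisation]
    rfl

/-- The opens of the canonical adapted frame cover are affine. [folklore] -/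
theorem isAffineOpen_adaptedFrameCover_U (x : Z₀) :
    IsAffineOpen ((adaptedFrameCover i hS h₁ h₃).U x) :=
  isAffineOpen_affineAdaptedOpen i hS h₁ h₃ x

/-- The canonical adapted frame cover covers `Z₁` (since `i` is surjective). [folklore] -/
theorem iSup_adaptedFrameCover_U [Surjective i] : ⨆ x, (adaptedFrameCover i hS h₁ h₃).U x = ⊤ := by
  refine top_le_iff.mp fun z _ => ?_
  obtain ⟨x, rfl⟩ := i.surjective z
  exact Opens.mem_iSup.mpr ⟨x, mem_affineAdaptedOpen i hS h₁ h₃ x⟩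

/-- Every point of `Z₀` lies in the preimage of some open of the canonical adapted cover.
[folklore] -/
theorem mem_preimage_adaptedFrameCover_U (x : Z₀) : x ∈ i ⁻¹ᵁ (adaptedFrameCover i hS h₁ h₃).U x :=
  mem_affineAdaptedOpen i hS h₁ h₃ x

include hS h₁ h₃ in
/-- **Adapted frame covers by affine opens exist** along a surjective closed immersion, for any short
exact sequence of `𝒪_{Z₀}`-modules with finite locally free ends. [cite: Hartshorne1977, II Ex. 5.7 (b)] -/
theorem exists_adaptedFrameCover [Surjective i] :
    ∃ A : AdaptedFrameCover i S Z₀, (∀ x, IsAffineOpen (A.U x)) ∧ ⨆ x, A.U x = ⊤ :=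
  ⟨adaptedFrameCover i hS h₁ h₃, isAffineOpen_adaptedFrameCover_U i hS h₁ h₃,
    iSup_adaptedFrameCover_U i hS h₁ h₃⟩

end Existence

end Literature.AlgebraicGeometry.Deformation

end
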